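import Summits.AnomalousDissipation.AnomalousDissipation.Theorems.NeutralTaylorWavesTaylorWaveQuasiSteadyStubFormalExpansionW
import Summits.AnomalousDissipation.AnomalousDissipation.Theorems.NeutralTaylorWavesTaylorWaveQuasiSteadyStubDissipationLawWTools

/-!
# Stub `stub_truncationW` of the line `windfibred` (rev 3)
# (crux stmt-AnomalousDissipation-16293, `NeutralTaylorWaves.TaylorWaveQuasiSteady`)

**Truncation: formal solutions of the ε-free hierarchy give the level-`n` profiles of `stub_profilesW`**
(the registered signature, verbatim, is the last theorem: `stub_formalExpansionW → stub_hierarchyW → stub_profilesW`).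

Given the formal expansion (hypothesis 1: the truncated sums `Pₙ = ∑_{a<N+1} ε^a P_a`, `Qₙ`, `cₙ` are smooth,
`∂ ∑ = ∑ ∂`, `ε·tsDiv ε Pₙ = ∑_{s<N+2} ε^s d_s`, `ε·tsResidual ε Pₙ Qₙ cₙ = ∑_{s<2N+4} ε^s M_s`) and, for every
order `N`, ε-free axis-invariant families `(P_a, Q_a, c_a)` with `d_s = 0 (s ≤ N+1)`, `M_s = 0 (s ≤ N)`
(hypothesis 2), the profile-level statement holds with the same `j, i₀, G, f, ε₀` and energy level `E + 1`:
for `K` take the order-`K` family and, at level `n` (`ε = ε_n`, `ν_n = ε²`), the truncated sums.  Bookkeeping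
on the compact probability torus `T⁴` (§1 `ε`-polynomial estimates; §2 continuity of the coefficient profiles,
hence uniform bounds by `DissipationLaw.exists_forall_norm_le`): drift `|cₙ| ≤ ∑|c_a|`; derivative bounds
`(K+1)·sup` from `∂ ∑ = ∑ ∂` (the mixed one by expanding the derived family `∂_θ P_a` once more); energy
`‖Pₙ‖ ≤ √E + ε K B₀`, so `‖Pₙ‖² ≤ E + 1` for `n ≥ n₀`, and below the threshold the ZERO profile is used (§3);
loudness `|∫ |k|²(‖∂_θPₙ‖² − ‖∂_θP₀‖²)| ≤ 3K₀²(εKB₁)(2B₁ + KB₁)` with `∫ |k|²‖∂_θP₀‖² = ε₀`; EXACT horizontal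
means (§4): `∫_{T³} (P_a ∘ e_n)_l = ∫_{T⁴} (P_a)_l` by the fast-phase averaging lemma
`DissipationLaw.abs_integral_comp_phaseMap_sub_integral_le` with Lipschitz constant `0` (axis invariance
`∂_{i₀} P_a = 0`, `∂_{i₀} G = 0`), then `(∫ P_a)_{0,1} = 0`; exact incompressibility `ε·tsDiv = ∑ ε^s d_s = 0`;
residual `ε·R = ∑_{K<s<2K+4} ε^s M_s`, whence `‖R‖² ≤ ((2K+4) sup‖M_s‖)² ν_n^K`.
Source: folklore (truncation of BKW/WKB hierarchies; Cheverry–Guès–Métivier, Ann. Sci. ENS 36 (2003) §2).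
-/

-- `Summit.<Summit>.<Problem>` is the tree's mandated summit-side namespace (CONVENTIONS §2); for this
-- single-conjunct summit the two coincide, so the duplicate is deliberate.
set_option linter.dupNamespace false

noncomputable section

open scoped BigOperators Topology InnerProductSpace ContDiff
open Filter MeasureTheory
open Literature.Analysis.FunctionSpaces Literature.Analysis.FunctionSpaces.Torus

namespace Summit.AnomalousDissipation.AnomalousDissipation.Theorems.TaylorWaveQuasiSteady.Truncation

open Summit.AnomalousDissipation.AnomalousDissipation.Theorems.TaylorWaveQuasiSteady

variable {F : Type*} [NormedAddCommGroup F] [NormedSpace ℝ F]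

/-! ## §1 Elementary estimates on `ε`-polynomials -/

/-- `‖∑_{a ∈ s} ε^a • v_a‖ ≤ |s| B` for `0 ≤ ε ≤ 1` and `‖v_a‖ ≤ B`. [folklore] -/
theorem norm_sum_pow_smul_le (s : Finset ℕ) (v : ℕ → F) {ε B : ℝ} (hε0 : 0 ≤ ε) (hε1 : ε ≤ 1)
    (hv : ∀ a ∈ s, ‖v a‖ ≤ B) : ‖∑ a ∈ s, ε ^ a • v a‖ ≤ s.card * B := by
  have h : ∀ a ∈ s, ‖ε ^ a • v a‖ ≤ B := fun a ha => by
    rw [norm_smul, norm_pow, Real.norm_eq_abs, abs_of_nonneg hε0]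
    exact (mul_le_mul (pow_le_one₀ hε0 hε1) (hv a ha) (norm_nonneg _) zero_le_one).trans_eq (one_mul B)
  refine (norm_sum_le _ _).trans ((Finset.sum_le_sum h).trans (le_of_eq ?_))
  rw [Finset.sum_const, nsmul_eq_mul]

/-- The tail of an `ε`-polynomial: `‖∑_{a<N+1} ε^a • v_a − v_0‖ ≤ ε (N B)` for `0 ≤ ε ≤ 1`, `‖v_a‖ ≤ B`. [folklore] -/
theorem norm_sum_pow_smul_sub_le (N : ℕ) (v : ℕ → F) {ε B : ℝ} (hε0 : 0 ≤ ε) (hε1 : ε ≤ 1)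
    (hv : ∀ a ∈ Finset.range (N + 1), ‖v a‖ ≤ B) :
    ‖(∑ a ∈ Finset.range (N + 1), ε ^ a • v a) - v 0‖ ≤ ε * (N * B) := by
  rw [Finset.sum_range_succ', pow_zero, one_smul, add_sub_cancel_right]
  have h : ∑ a ∈ Finset.range N, ε ^ (a + 1) • v (a + 1) = ε • ∑ a ∈ Finset.range N, ε ^ a • v (a + 1) := by
    rw [Finset.smul_sum]
    exact Finset.sum_congr rfl fun a _ => by rw [pow_succ', mul_smul]
  rw [h, norm_smul, Real.norm_eq_abs, abs_of_nonneg hε0]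
  refine mul_le_mul_of_nonneg_left ?_ hε0
  have h2 := norm_sum_pow_smul_le (Finset.range N) (fun a => v (a + 1)) hε0 hε1
    (fun a ha => hv (a + 1) (Finset.mem_range.2 (Nat.succ_lt_succ (Finset.mem_range.1 ha))))
  rwa [Finset.card_range] at h2

/-- **Tail estimate of the formal residual**: if `ε • R = ∑_{s<2K+4} ε^s • M_s` with `M_s = 0` for `s ≤ K`,
`‖M_s‖ ≤ B` and `0 < ε ≤ 1`, then `‖R‖² ≤ ((2K+4)B)² (ε²)^K`. [folklore] -/
theorem norm_sq_le_of_smul_eq_sum (K : ℕ) (M : ℕ → F) {ε B : ℝ} (hε0 : 0 < ε) (hε1 : ε ≤ 1) (hB : 0 ≤ B)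
    (hM : ∀ s ∈ Finset.range (2 * K + 4), ‖M s‖ ≤ B) (h0 : ∀ s, s ≤ K → M s = 0) {R : F}
    (hR : ε • R = ∑ s ∈ Finset.range (2 * K + 4), ε ^ s • M s) :
    ‖R‖ ^ 2 ≤ ((2 * K + 4) * B) ^ 2 * (ε ^ 2) ^ K := by
  have hterm : ∀ s ∈ Finset.range (2 * K + 4), ‖ε ^ s • M s‖ ≤ ε ^ (K + 1) * B := by
    intro s hs
    rcases le_or_gt s K with hsK | hsK
    · rw [h0 s hsK, smul_zero, norm_zero]
      positivity
    · rw [norm_smul, norm_pow, Real.norm_eq_abs, abs_of_pos hε0]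
      exact mul_le_mul (pow_le_pow_of_le_one hε0.le hε1 hsK) (hM s hs) (norm_nonneg _) (by positivity)
  have h1 : ε * ‖R‖ ≤ ((2 * K + 4) * B * ε ^ K) * ε := by
    calc ε * ‖R‖ = ‖ε • R‖ := by rw [norm_smul, Real.norm_eq_abs, abs_of_pos hε0]
      _ ≤ ∑ s ∈ Finset.range (2 * K + 4), ‖ε ^ s • M s‖ := by rw [hR]; exact norm_sum_le _ _
      _ ≤ ∑ _s ∈ Finset.range (2 * K + 4), ε ^ (K + 1) * B := Finset.sum_le_sum hterm
      _ = ((2 * K + 4) * B * ε ^ K) * ε := by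
          rw [Finset.sum_const, Finset.card_range, nsmul_eq_mul, pow_succ]; push_cast; ring
  have h2 : ‖R‖ ≤ (2 * K + 4) * B * ε ^ K := le_of_mul_le_mul_right (by rwa [mul_comm] at h1) hε0
  calc ‖R‖ ^ 2 ≤ ((2 * K + 4) * B * ε ^ K) ^ 2 := pow_le_pow_left₀ (norm_nonneg _) h2 2
    _ = ((2 * K + 4) * B) ^ 2 * (ε ^ 2) ^ K := by rw [mul_pow, ← pow_mul, ← pow_mul, mul_comm K 2]

omit [NormedSpace ℝ F] in
/-- `|‖S‖² − ‖A‖²| ≤ ‖S − A‖ (2‖A‖ + ‖S − A‖)`. [folklore] -/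
theorem abs_norm_sq_sub_norm_sq_le (S A : F) : |‖S‖ ^ 2 - ‖A‖ ^ 2| ≤ ‖S - A‖ * (2 * ‖A‖ + ‖S - A‖) := by
  rw [sq_sub_sq, abs_mul]
  have h1 : |‖S‖ - ‖A‖| ≤ ‖S - A‖ := abs_norm_sub_norm_le S A
  have h2 : |‖S‖ + ‖A‖| ≤ 2 * ‖A‖ + ‖S - A‖ := by
    rw [abs_of_nonneg (by positivity)]
    have h := norm_le_insert' S A
    linarith
  calc |‖S‖ + ‖A‖| * |‖S‖ - ‖A‖| ≤ (2 * ‖A‖ + ‖S - A‖) * ‖S - A‖ :=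
        mul_le_mul h2 h1 (abs_nonneg _) (by positivity)
    _ = ‖S - A‖ * (2 * ‖A‖ + ‖S - A‖) := mul_comm _ _

/-! ## §2 Continuity and smoothness of the two-scale vocabulary -/

/-- `slow : T⁴ → T³` is continuous. [folklore] -/
theorem continuous_slow : Continuous (slow : UnitAddTorus (Fin 4) → UnitAddTorus (Fin 3)) :=
  continuous_pi fun _ => continuous_apply _

attribute [local fun_prop] continuous_slow Continuous.if_const

/-- The dissipation density of a smooth profile is continuous. [folklore] -/
theorem continuous_dissDensity (j : Fin 3 → ℤ) {G : UnitAddTorus (Fin 3) → ℝ} (hG : IsSmooth G)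
    {P : UnitAddTorus (Fin 4) → EuclideanSpace ℝ (Fin 3)} (hP : IsSmooth P) : Continuous (dissDensity j G P) := by
  have hk : ∀ i, Continuous (phaseGrad j G i) := fun i => (DissipationLaw.isSmooth_phaseGrad j hG i).continuous
  have hd : Continuous (partialDeriv (Fin.last 3) P) := (hP.partialDeriv _).continuous
  unfold dissDensity
  fun_prop

/-- The coefficient profiles `hierarchyCoeff … s` of smooth data are continuous (finite sums, products and
constant-condition `if`s of continuous functions: `fun_prop` with `Continuous.if_const`; smoothness of the
slow/fast derivatives is `FormalExpansion.isSmooth_sDeriv/_fDeriv`). [folklore] -/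
theorem continuous_hierarchyCoeff (j : Fin 3 → ℤ) {G : UnitAddTorus (Fin 3) → ℝ} (hG : IsSmooth G)
    {f : UnitAddTorus (Fin 3) → EuclideanSpace ℝ (Fin 3)} (hf : Continuous f) (N : ℕ)
    {P : ℕ → UnitAddTorus (Fin 4) → EuclideanSpace ℝ (Fin 3)} {Q : ℕ → UnitAddTorus (Fin 4) → ℝ}
    (hP : ∀ a, IsSmooth (P a)) (hQ : ∀ a, IsSmooth (Q a)) (c : ℕ → ℝ) (s : ℕ) :
    Continuous (hierarchyCoeff j G f N P Q c s) := by
  have hS : ∀ {Φ : UnitAddTorus (Fin 4) → EuclideanSpace ℝ (Fin 3)}, IsSmooth Φ → ∀ i : Fin 3,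
      IsSmooth (sDeriv i Φ) ∧ IsSmooth (fDeriv j G i Φ) :=
    fun hΦ i => ⟨FormalExpansion.isSmooth_sDeriv hΦ i, FormalExpansion.isSmooth_fDeriv j hG i hΦ⟩
  have hPc : ∀ a, Continuous (P a) := fun a => (hP a).continuous
  have h1 : ∀ a l, Continuous (sDeriv l (P a)) := fun a l => (hS (hP a) l).1.continuous
  have h2 : ∀ a l, Continuous (fDeriv j G l (P a)) := fun a l => (hS (hP a) l).2.continuous
  have h3 : ∀ a i, Continuous (sDeriv i (sDeriv i (P a))) := fun a i => (hS (hS (hP a) i).1 i).1.continuous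
  have h4 : ∀ a i, Continuous (sDeriv i (fDeriv j G i (P a))) := fun a i => (hS (hS (hP a) i).2 i).1.continuous
  have h5 : ∀ a i, Continuous (fDeriv j G i (sDeriv i (P a))) := fun a i => (hS (hS (hP a) i).1 i).2.continuous
  have h6 : ∀ a i, Continuous (fDeriv j G i (fDeriv j G i (P a))) := fun a i => (hS (hS (hP a) i).2 i).2.continuous
  have h7 : ∀ a i, Continuous (sDeriv i (Q a)) := fun a i => (FormalExpansion.isSmooth_sDeriv (hQ a) i).continuous
  have h8 : ∀ a i, Continuous (fDeriv j G i (Q a)) := fun a i =>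
    (FormalExpansion.isSmooth_fDeriv j hG i (hQ a)).continuous
  unfold hierarchyCoeff
  fun_prop

/-! ## §3 The zero profile (the witness below the energy threshold) -/

/-- Partial derivatives of a constant profile vanish. [folklore] -/
theorem partialDeriv_constFun {d : Type*} [Fintype d] [DecidableEq d] (m : d) (v : F) :
    partialDeriv m (fun _ : UnitAddTorus d => v) = fun _ => 0 := by
  funext y
  simp [Torus.partialDeriv, Torus.lineDeriv]

/-- Two-scale derivatives of a constant profile vanish. [folklore] -/
theorem tsDeriv_constFun (ε : ℝ) (j : Fin 3 → ℤ) (G : UnitAddTorus (Fin 3) → ℝ) (i : Fin 3) (v : F) :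
    tsDeriv ε j G i (fun _ : UnitAddTorus (Fin 4) => v) = fun _ => 0 := by
  funext y
  simp [tsDeriv, partialDeriv_constFun]

/-- The two-scale residual of the zero profile is `−f ∘ slow`. [folklore] -/
theorem tsResidual_zero (ε : ℝ) (j : Fin 3 → ℤ) (G : UnitAddTorus (Fin 3) → ℝ)
    (f : UnitAddTorus (Fin 3) → EuclideanSpace ℝ (Fin 3)) (y : UnitAddTorus (Fin 4)) :
    tsResidual ε j G f (fun _ => 0) (fun _ => 0) 0 y = -f (slow y) := by
  have hgrad : tsGrad ε j G (fun _ => (0 : ℝ)) y = 0 := by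
    ext i
    simp [tsGrad, tsDeriv_constFun]
  simp [tsResidual, tsConvect, tsLaplacian, tsDeriv_constFun, hgrad]

/-! ## §4 Components of vector integrals and fast-phase averaging of axis-invariant profiles -/

/-- Components commute with the Bochner integral of an integrable `ℝ³`-valued function. [folklore] -/
theorem integral_apply_eq {X : Type*} [MeasurableSpace X] {μ : Measure X}
    {W : X → EuclideanSpace ℝ (Fin 3)} (hW : Integrable W μ) (l : Fin 3) :
    (∫ x, W x ∂μ) l = ∫ x, (W x) l ∂μ := by
  have h := ((EuclideanSpace.proj l : EuclideanSpace ℝ (Fin 3) →L[ℝ] ℝ).integral_comp_comm hW).symm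
  simpa only [PiLp.proj_apply] using h

/-- **Exact fast-phase averaging of axis-invariant profiles**: if `j i₀ ≠ 0`, `∂_{i₀} G = 0` and the smooth
profile `Φ` does not depend on `x_{i₀}`, then `∫_{T³} Φ ∘ e_n = ∫_{T⁴} Φ` componentwise. [folklore] -/
theorem integral_comp_phaseMap_apply_eq (j : Fin 3 → ℤ) {i₀ : Fin 3} (hj : j i₀ ≠ 0)
    {G : UnitAddTorus (Fin 3) → ℝ} (hG : IsSmooth G) (hG0 : ∀ x, partialDeriv i₀ G x = 0) (n : ℕ)
    {Φ : UnitAddTorus (Fin 4) → EuclideanSpace ℝ (Fin 3)} (hΦ : IsSmooth Φ) (hΦ0 : ∀ y, sDeriv i₀ Φ y = 0)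
    (l : Fin 3) : (∫ x, Φ (phaseMap j G n x)) l = (∫ y, Φ y) l := by
  have hGinv : ∀ (x : UnitAddTorus (Fin 3)) (s : UnitAddCircle), G (x + Pi.single i₀ s) = G x :=
    DissipationLaw.apply_add_single_eq_of_partialDeriv_eq_zero (hG.isContDiff (by simp)) i₀ hG0
  have hinv : ∀ (z : UnitAddTorus (Fin 4)) (s : UnitAddCircle), Φ (z + Pi.single (Fin.castSucc i₀) s) = Φ z :=
    DissipationLaw.apply_add_single_eq_of_partialDeriv_eq_zero (hΦ.isContDiff (by simp)) _ hΦ0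
  have hcont : Continuous fun y => (Φ y) l := (PiLp.continuous_apply 2 _ l).comp hΦ.continuous
  have h := DissipationLaw.abs_integral_comp_phaseMap_sub_integral_le j hj hG.continuous hGinv n hcont (D := 0)
    (fun z t => by rw [hinv, sub_self, abs_zero, zero_mul])
  rw [zero_mul, abs_nonpos_iff, sub_eq_zero] at h
  rw [integral_apply_eq (ResidualTransfer.isSmooth_comp_phaseMap j hG hΦ n).integrable,
    integral_apply_eq hΦ.integrable]
  exact h

/-! ## §5 The registered stub -/

/-- **stub_truncationW** (truncation; the registered signature, verbatim): the formal expansion identities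
(hypothesis 1, `stub_formalExpansionW`) and the solvability of the ε-free hierarchy to every order by
axis-invariant, horizontally mean-free profiles of energy `≤ E` and loudness `ε₀` (hypothesis 2, `stub_hierarchyW`)
imply the profile-level statement `stub_profilesW` with the data `j, i₀, G, f`, energy `E + 1` and loudness `ε₀`:
at level `n ≥ n₀(K)` the witnesses are the order-`K` truncated sums at `ε = ε_n`, below `n₀` the zero profile;
`C` is the sum of the seven constants of the clauses. [folklore] -/
theorem stub_truncationW : (∀ (j : Fin 3 → ℤ) (G : UnitAddTorus (Fin 3) → ℝ) (f : UnitAddTorus (Fin 3) → EuclideanSpace ℝ (Fin 3)) (N : ℕ) (P : ℕ → UnitAddTorus (Fin 4) → EuclideanSpace ℝ (Fin 3)) (Q : ℕ → UnitAddTorus (Fin 4) → ℝ) (c : ℕ → ℝ) (ε : ℝ), Literature.Analysis.FunctionSpaces.Torus.IsSmooth G → (∀ a, Literature.Analysis.FunctionSpaces.Torus.IsSmooth (P a)) → (∀ a, Literature.Analysis.FunctionSpaces.Torus.IsSmooth (Q a)) → Literature.Analysis.FunctionSpaces.Torus.IsSmooth (fun y => ∑ a ∈ Finset.range (N + 1),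 ε ^ a • P a y) ∧ Literature.Analysis.FunctionSpaces.Torus.IsSmooth (fun y => ∑ a ∈ Finset.range (N + 1), ε ^ a * Q a y) ∧ (∀ (m : Fin 4) (y : UnitAddTorus (Fin 4)), Literature.Analysis.FunctionSpaces.Torus.partialDeriv m (fun y => ∑ a ∈ Finset.range (N + 1), ε ^ a • P a y) y = ∑ a ∈ Finset.range (N + 1), ε ^ a • Literature.Analysis.FunctionSpaces.Torus.partialDeriv m (P a) y) ∧ (ε ≠ 0 → ∀ y : UnitAddTorus (Fin 4), ε * tsDiv ε j G (fun y => ∑ a ∈ Finset.range (N + 1), ε ^ a • P a y) y = ∑ s ∈ Finset.range (N + 2), ε ^ s * divCoeff j G N P s y ∧ ε • tsResidual ε j G f (fun y => ∑ a ∈ Finset.range (N + 1), ε ^ a • P a y) (fun y => ∑ a ∈ Finset.range (N + 1), ε ^ a * Q a y) (∑ a ∈ Finset.range (N + 1), ε ^ a * c a) y = ∑ s ∈ Finset.range (2 * N + 4), ε ^ s • hierarchyCoeff j G f N P Q c s y)) → (∃ (j : Fin 3 → ℤ) (i₀ : Fin 3) (G : UnitAddTorus (Fin 3) → ℝ) (f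 : UnitAddTorus (Fin 3) → EuclideanSpace ℝ (Fin 3)) (E ε₀ : ℝ), j i₀ ≠ 0 ∧ Literature.Analysis.FunctionSpaces.Torus.IsSmooth G ∧ (∀ x, Literature.Analysis.FunctionSpaces.Torus.partialDeriv i₀ G x = 0) ∧ Literature.Analysis.FunctionSpaces.Torus.IsSmooth f ∧ Literature.Analysis.FunctionSpaces.Torus.IsDivFree f ∧ Literature.Analysis.FunctionSpaces.Torus.HasZeroMean f ∧ 0 < ε₀ ∧ ∀ N : ℕ, ∃ (P : ℕ → UnitAddTorus (Fin 4) → EuclideanSpace ℝ (Fin 3)) (Q : ℕ → UnitAddTorus (Fin 4) → ℝ) (c : ℕ → ℝ), (∀ a, Literature.Analysis.FunctionSpaces.Torus.IsSmooth (P a)) ∧ (∀ a, Literature.Analysis.FunctionSpaces.Torus.IsSmooth (Q a)) ∧ (∀ a y, sDeriv i₀ (P a) y = 0) ∧ (∀ a, (∫ y, P a y) 0 = 0 ∧ (∫ y, P a y) 1 = 0) ∧ (∀ y, ‖P 0 y‖ ^ 2 ≤ E) ∧ (∫ y, dissDensity j G (P 0) y) = ε₀ ∧ (∀ s, s ≤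 N + 1 → ∀ y, divCoeff j G N P s y = 0) ∧ (∀ s, s ≤ N → ∀ y, hierarchyCoeff j G f N P Q c s y = 0)) → (∃ (j : Fin 3 → ℤ) (i₀ : Fin 3) (G : UnitAddTorus (Fin 3) → ℝ) (f : UnitAddTorus (Fin 3) → EuclideanSpace ℝ (Fin 3)) (E ε₀ : ℝ), j i₀ ≠ 0 ∧ Literature.Analysis.FunctionSpaces.Torus.IsSmooth G ∧ (∀ x, Literature.Analysis.FunctionSpaces.Torus.partialDeriv i₀ G x = 0) ∧ Literature.Analysis.FunctionSpaces.Torus.IsSmooth f ∧ Literature.Analysis.FunctionSpaces.Torus.IsDivFree f ∧ Literature.Analysis.FunctionSpaces.Torus.HasZeroMean f ∧ 0 < ε₀ ∧ ∀ K : ℕ, ∃ C : ℝ, ∀ n : ℕ, ∃ (P : UnitAddTorus (Fin 4) → EuclideanSpace ℝ (Fin 3)) (Q : UnitAddTorus (Fin 4) → ℝ) (c : ℝ), Literature.Analysis.FunctionSpaces.Torus.IsSmooth P ∧ Literature.Analysis.FunctionSpaces.Torus.IsSmooth Q ∧ |c| ≤ C ∧ (∀ y, ‖P y‖ ^ 2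 ≤ E) ∧ (∀ (i : Fin 3) y, ‖Literature.Analysis.FunctionSpaces.Torus.partialDeriv i.castSucc P y‖ ≤ C) ∧ (∀ y, ‖Literature.Analysis.FunctionSpaces.Torus.partialDeriv (Fin.last 3) P y‖ ≤ C) ∧ (∀ (i : Fin 3) y, ‖Literature.Analysis.FunctionSpaces.Torus.partialDeriv i.castSucc (Literature.Analysis.FunctionSpaces.Torus.partialDeriv (Fin.last 3) P) y‖ ≤ C) ∧ |(∫ y, dissDensity j G P y) - ε₀| ≤ C * epsN n ∧ (∫ x, P (phaseMap j G n x)) 0 = 0 ∧ (∫ x, P (phaseMap j G n x)) 1 = 0 ∧ (∀ y, tsDiv (epsN n) j G P y = 0) ∧ (∀ y, ‖tsResidual (epsN n) j G f P Q c y‖ ^ 2 ≤ C * nuN n ^ K)) := by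
  intro hX hH
  obtain ⟨j, i₀, G, f, E, ε₀, hj, hG, hG0, hf, hfdiv, hfmean, hε₀, hN⟩ := hH
  refine ⟨j, i₀, G, f, E + 1, ε₀, hj, hG, hG0, hf, hfdiv, hfmean, hε₀, fun K => ?_⟩
  obtain ⟨P, Q, c, hP, hQ, hPi₀, hPmean, hP0E, hdiss, hdivc, hhier⟩ := hN K
  have hE : 0 ≤ E := (sq_nonneg _).trans (hP0E 0)
  -- uniform bounds of finitely many continuous functions on the compact tori (indexed by `Fin`-types)
  obtain ⟨B₀, hB₀, hPB⟩ := DissipationLaw.exists_forall_norm_le (fun a : Fin (K + 1) => P a)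
    fun a => (hP a).continuous
  obtain ⟨B₁, hB₁, hdB⟩ := DissipationLaw.exists_forall_norm_le
    (fun p : Fin 4 × Fin (K + 1) => partialDeriv p.1 (P p.2)) fun p => ((hP p.2).partialDeriv p.1).continuous
  obtain ⟨B₂, hB₂, hd2B⟩ := DissipationLaw.exists_forall_norm_le
    (fun p : Fin 3 × Fin (K + 1) => partialDeriv (Fin.castSucc p.1) (partialDeriv (Fin.last 3) (P p.2)))
    fun p => (((hP p.2).partialDeriv _).partialDeriv _).continuous
  obtain ⟨B₃, hB₃, hMB⟩ := DissipationLaw.exists_forall_norm_le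
    (fun s : Fin (2 * K + 4) => hierarchyCoeff j G f K P Q c s)
    fun s => continuous_hierarchyCoeff j hG hf.continuous K hP hQ c s
  obtain ⟨Bf, hBf, hfB⟩ := DissipationLaw.exists_forall_norm_le (fun _ : Unit => f) fun _ => hf.continuous
  obtain ⟨K₀, hK₀, hk0⟩ := DissipationLaw.exists_forall_norm_le (fun i => phaseGrad j G i)
    fun i => (DissipationLaw.isSmooth_phaseGrad j hG i).continuous
  have hdB' : ∀ (m : Fin 4), ∀ a ∈ Finset.range (K + 1), ∀ y, ‖partialDeriv m (P a) y‖ ≤ B₁ :=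
    fun m a ha y => hdB ⟨m, a, Finset.mem_range.1 ha⟩ y
  have hcard : ((Finset.range (K + 1)).card : ℝ) = K + 1 := by rw [Finset.card_range, Nat.cast_add_one]
  -- the energy threshold `n₀` and the constant `C`
  obtain ⟨n₀, hn₀⟩ := exists_nat_ge (K * B₀ * (2 * Real.sqrt E + K * B₀))
  obtain ⟨C, hC1, hC2, hC3, hC4, hC5, hC6, hC7, hC0⟩ : ∃ C : ℝ, (∑ a ∈ Finset.range (K + 1), |c a|) ≤ C ∧
      (Finset.range (K + 1)).card * B₁ ≤ C ∧ (Finset.range (K + 1)).card * B₂ ≤ C ∧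
      3 * (K₀ ^ 2 * ((K * B₁) * (2 * B₁ + K * B₁))) ≤ C ∧ ((2 * K + 4) * B₃) ^ 2 ≤ C ∧
      ε₀ * (n₀ + 1) ≤ C ∧ Bf ^ 2 * (n₀ + 1) ^ (2 * K) ≤ C ∧ 0 ≤ C := by
    have ht1 : 0 ≤ ∑ a ∈ Finset.range (K + 1), |c a| := Finset.sum_nonneg fun a _ => abs_nonneg _
    have ht2 : 0 ≤ (K + 1 : ℝ) * B₁ := by positivity
    have ht3 : 0 ≤ (K + 1 : ℝ) * B₂ := by positivity
    have ht4 : 0 ≤ 3 * (K₀ ^ 2 * ((K * B₁) * (2 * B₁ + K * B₁))) := by positivity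
    have ht5 : 0 ≤ ((2 * K + 4 : ℝ) * B₃) ^ 2 := by positivity
    have ht6 : 0 ≤ ε₀ * (n₀ + 1 : ℝ) := by positivity
    have ht7 : 0 ≤ Bf ^ 2 * (n₀ + 1 : ℝ) ^ (2 * K) := by positivity
    rw [hcard]
    exact ⟨(∑ a ∈ Finset.range (K + 1), |c a|) + (K + 1) * B₁ + (K + 1) * B₂ +
      3 * (K₀ ^ 2 * ((K * B₁) * (2 * B₁ + K * B₁))) + ((2 * K + 4) * B₃) ^ 2 + ε₀ * (n₀ + 1) +
      Bf ^ 2 * (n₀ + 1) ^ (2 * K), by linarith, by linarith, by linarith, by linarith, by linarith, by linarith,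
      by linarith, by linarith⟩
  refine ⟨C, fun n => ?_⟩
  rcases lt_or_ge n n₀ with hn | hn
  · -- levels below the threshold: the zero profile
    have hge1 : 1 ≤ (n₀ + 1 : ℝ) * epsN n := by
      have h1 : (n : ℝ) + 1 ≤ n₀ + 1 := by exact_mod_cast Nat.succ_le_succ hn.le
      rw [epsN, mul_one_div, le_div_iff₀ (by positivity), one_mul]
      exact h1
    refine ⟨fun _ => 0, fun _ => 0, 0, isSmooth_const _, isSmooth_const _, ?_, ?_, ?_, ?_, ?_, ?_, ?_, ?_, ?_, ?_⟩
    · rw [abs_zero]; exact hC0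
    · intro y; rw [norm_zero, zero_pow two_ne_zero]; linarith
    · intro i y; simp only [partialDeriv_constFun, norm_zero]; exact hC0
    · intro y; simp only [partialDeriv_constFun, norm_zero]; exact hC0
    · intro i y; simp only [partialDeriv_constFun, norm_zero]; exact hC0
    · have h0 : ∀ y, dissDensity j G (fun _ : UnitAddTorus (Fin 4) => (0 : EuclideanSpace ℝ (Fin 3))) y = 0 :=
        fun y => by simp [dissDensity, partialDeriv_constFun]
      simp only [h0, integral_zero, zero_sub, abs_neg, abs_of_pos hε₀]
      calc ε₀ ≤ ε₀ * ((n₀ + 1) * epsN n) := le_mul_of_one_le_right hε₀.le hge1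
        _ = ε₀ * (n₀ + 1) * epsN n := by ring
        _ ≤ C * epsN n := mul_le_mul_of_nonneg_right hC6 (epsN_pos n).le
    · simp
    · simp
    · intro y; simp [tsDiv, tsDeriv_constFun]
    · intro y
      rw [tsResidual_zero, norm_neg]
      have h1 : ‖f (slow y)‖ ^ 2 ≤ Bf ^ 2 := pow_le_pow_left₀ (norm_nonneg _) (hfB () _) 2
      have h2 : (1 : ℝ) ≤ ((n₀ + 1) * epsN n) ^ (2 * K) := one_le_pow₀ hge1
      calc ‖f (slow y)‖ ^ 2 ≤ Bf ^ 2 * ((n₀ + 1) * epsN n) ^ (2 * K) :=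
            h1.trans (le_mul_of_one_le_right (sq_nonneg Bf) h2)
        _ = Bf ^ 2 * (n₀ + 1) ^ (2 * K) * nuN n ^ K := by rw [nuN, ← pow_mul, mul_pow]; ring
        _ ≤ C * nuN n ^ K := mul_le_mul_of_nonneg_right hC7 (pow_nonneg (nuN_pos n).le K)
  · -- levels above the threshold: the truncated formal solution at `ε = ε_n`
    have hε0 : 0 < epsN n := epsN_pos n
    have hε1 : epsN n ≤ 1 := DissipationLaw.epsN_le_one n
    obtain ⟨hPs, hQs, hdP, hε'⟩ := hX j G f K P Q c (epsN n) hG hP hQ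
    have hmeanv : ∀ l : Fin 3, (∫ x, ∑ a ∈ Finset.range (K + 1), epsN n ^ a • P a (phaseMap j G n x)) l =
        ∑ a ∈ Finset.range (K + 1), epsN n ^ a * (∫ y, P a y) l := by
      intro l
      rw [integral_finsetSum _ fun a _ =>
        ((ResidualTransfer.isSmooth_comp_phaseMap j hG (hP a) n).continuous.fun_const_smul
          (epsN n ^ a)).integrable_unitAddTorus, WithLp.ofLp_sum, Finset.sum_apply]
      refine Finset.sum_congr rfl fun a _ => ?_
      rw [integral_smul, PiLp.smul_apply, smul_eq_mul, integral_comp_phaseMap_apply_eq j hj hG hG0 n (hP a) (hPi₀ a)]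
    refine ⟨fun y => ∑ a ∈ Finset.range (K + 1), epsN n ^ a • P a y,
      fun y => ∑ a ∈ Finset.range (K + 1), epsN n ^ a * Q a y,
      ∑ a ∈ Finset.range (K + 1), epsN n ^ a * c a, hPs, hQs, ?_, ?_, ?_, ?_, ?_, ?_, ?_, ?_, ?_, ?_⟩
    · -- drift
      have h1 : |∑ a ∈ Finset.range (K + 1), epsN n ^ a * c a| ≤ ∑ a ∈ Finset.range (K + 1), |c a| :=
        (Finset.abs_sum_le_sum_abs _ _).trans (Finset.sum_le_sum fun a _ => by
          rw [abs_mul, abs_pow, abs_of_pos hε0]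
          exact mul_le_of_le_one_left (abs_nonneg _) (pow_le_one₀ hε0.le hε1))
      exact h1.trans hC1
    · -- energy: `‖Pₙ‖ ≤ √E + ε K B₀` and `ε K B₀ (2√E + K B₀) ≤ 1` for `n ≥ n₀`
      intro y
      have htail := norm_sum_pow_smul_sub_le K (fun a => P a y) hε0.le hε1
        fun a ha => hPB ⟨a, Finset.mem_range.1 ha⟩ y
      have h0 : ‖P 0 y‖ ≤ Real.sqrt E := by
        have h := Real.abs_le_sqrt (hP0E y)
        rwa [abs_of_nonneg (norm_nonneg _)] at h
      have h1 : ‖∑ a ∈ Finset.range (K + 1), epsN n ^ a • P a y‖ ≤ Real.sqrt E + epsN n * (K * B₀) := by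
        have h := norm_add_le ((∑ a ∈ Finset.range (K + 1), epsN n ^ a • P a y) - P 0 y) (P 0 y)
        rw [sub_add_cancel] at h
        linarith
      have hsmall : epsN n * (K * B₀ * (2 * Real.sqrt E + K * B₀)) ≤ 1 := by
        have hn' : (n₀ : ℝ) ≤ n := by exact_mod_cast hn
        rw [epsN, one_div_mul_eq_div, div_le_one (by positivity)]
        linarith
      have hε2 : epsN n ^ 2 * (K * B₀) ^ 2 ≤ epsN n * (K * B₀) ^ 2 :=
        mul_le_mul_of_nonneg_right (pow_le_of_le_one hε0.le hε1 two_ne_zero) (sq_nonneg _)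
      -- `‖Pₙ‖² ≤ (√E + εKB₀)² = E + ε KB₀ 2√E + ε² (KB₀)² ≤ E + ε KB₀ (2√E + KB₀) ≤ E + 1`
      nlinarith [pow_le_pow_left₀ (norm_nonneg _) h1 2, Real.sq_sqrt hE]
    · -- slow derivatives
      intro i y
      rw [hdP]
      exact (norm_sum_pow_smul_le _ _ hε0.le hε1 fun a ha => hdB' _ a ha y).trans hC2
    · -- phase derivative
      intro y
      rw [hdP]
      exact (norm_sum_pow_smul_le _ _ hε0.le hε1 fun a ha => hdB' _ a ha y).trans hC2
    · -- mixed derivatives: expand `∂_θ` first (as a function), then `∂ᵢ` of the derived family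
      intro i y
      have hfun : partialDeriv (Fin.last 3) (fun y => ∑ a ∈ Finset.range (K + 1), epsN n ^ a • P a y) =
          fun y => ∑ a ∈ Finset.range (K + 1), epsN n ^ a • partialDeriv (Fin.last 3) (P a) y :=
        funext (hdP (Fin.last 3))
      obtain ⟨-, -, hdP', -⟩ := hX j G f K (fun a => partialDeriv (Fin.last 3) (P a)) Q c (epsN n) hG
        (fun a => (hP a).partialDeriv _) hQ
      rw [hfun, hdP']
      exact (norm_sum_pow_smul_le _ _ hε0.le hε1 fun a ha => hd2B ⟨i, a, Finset.mem_range.1 ha⟩ y).trans hC3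
    · -- loudness: `|∫ (dissDensity Pₙ − dissDensity P₀)| ≤ 3K₀²(ε K B₁)(2B₁ + K B₁)`
      rw [← hdiss, ← integral_sub (continuous_dissDensity j hG hPs).integrable_unitAddTorus
        (continuous_dissDensity j hG (hP 0)).integrable_unitAddTorus]
      have hpt : ∀ y, ‖dissDensity j G (fun y => ∑ a ∈ Finset.range (K + 1), epsN n ^ a • P a y) y -
          dissDensity j G (P 0) y‖ ≤ 3 * (K₀ ^ 2 * ((epsN n * (K * B₁)) * (2 * B₁ + K * B₁))) := by
        intro y
        rw [Real.norm_eq_abs]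
        unfold dissDensity
        rw [← Finset.sum_sub_distrib]
        refine (Finset.abs_sum_le_sum_abs _ _).trans ?_
        have hA : ‖partialDeriv (Fin.last 3) (P 0) y‖ ≤ B₁ := hdB' _ 0 (Finset.mem_range.2 (Nat.succ_pos K)) y
        have hT : ‖partialDeriv (Fin.last 3) (fun y => ∑ a ∈ Finset.range (K + 1), epsN n ^ a • P a y) y -
            partialDeriv (Fin.last 3) (P 0) y‖ ≤ epsN n * (K * B₁) := by
          rw [hdP]
          exact norm_sum_pow_smul_sub_le K (fun a => partialDeriv (Fin.last 3) (P a) y) hε0.le hε1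
            fun a ha => hdB' _ a ha y
        have hT1 : ‖partialDeriv (Fin.last 3) (fun y => ∑ a ∈ Finset.range (K + 1), epsN n ^ a • P a y) y -
            partialDeriv (Fin.last 3) (P 0) y‖ ≤ K * B₁ := hT.trans (mul_le_of_le_one_left (by positivity) hε1)
        have hterm : ∀ i ∈ (Finset.univ : Finset (Fin 3)),
            |phaseGrad j G i (slow y) ^ 2 *
                ‖partialDeriv (Fin.last 3) (fun y => ∑ a ∈ Finset.range (K + 1), epsN n ^ a • P a y) y‖ ^ 2 -
              phaseGrad j G i (slow y) ^ 2 * ‖partialDeriv (Fin.last 3) (P 0) y‖ ^ 2| ≤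
              K₀ ^ 2 * ((epsN n * (K * B₁)) * (2 * B₁ + K * B₁)) := by
          intro i _
          rw [← mul_sub, abs_mul, abs_of_nonneg (sq_nonneg _)]
          have hk : phaseGrad j G i (slow y) ^ 2 ≤ K₀ ^ 2 :=
            sq_le_sq' (abs_le.1 (hk0 i (slow y))).1 (abs_le.1 (hk0 i (slow y))).2
          refine mul_le_mul hk ((abs_norm_sq_sub_norm_sq_le _ _).trans ?_) (abs_nonneg _) (sq_nonneg _)
          exact mul_le_mul hT (by linarith) (by positivity) (by positivity)
        refine (Finset.sum_le_sum hterm).trans (le_of_eq ?_)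
        rw [Finset.sum_const, Finset.card_univ, Fintype.card_fin, nsmul_eq_mul, Nat.cast_ofNat]
      have h := norm_integral_le_of_norm_le_const (μ := volume) (Eventually.of_forall hpt)
      rw [probReal_univ, mul_one, Real.norm_eq_abs] at h
      refine h.trans ?_
      calc 3 * (K₀ ^ 2 * ((epsN n * (K * B₁)) * (2 * B₁ + K * B₁)))
          = 3 * (K₀ ^ 2 * ((K * B₁) * (2 * B₁ + K * B₁))) * epsN n := by ring
        _ ≤ C * epsN n := mul_le_mul_of_nonneg_right hC4 hε0.le
    · -- horizontal mean, component 0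
      rw [hmeanv]
      exact Finset.sum_eq_zero fun a _ => by rw [(hPmean a).1, mul_zero]
    · -- horizontal mean, component 1
      rw [hmeanv]
      exact Finset.sum_eq_zero fun a _ => by rw [(hPmean a).2, mul_zero]
    · -- exact two-scale incompressibility
      intro y
      have h1 := (hε' hε0.ne' y).1
      have h2 : ∑ s ∈ Finset.range (K + 2), epsN n ^ s * divCoeff j G K P s y = 0 :=
        Finset.sum_eq_zero fun s hs => by
          rw [hdivc s (by have := Finset.mem_range.1 hs; omega) y, mul_zero]
      rw [h2] at h1
      exact (mul_eq_zero.1 h1).resolve_left hε0.ne'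
    · -- the residual: only the orders `K < s < 2K + 4` survive
      intro y
      have h := norm_sq_le_of_smul_eq_sum K (fun s => hierarchyCoeff j G f K P Q c s y) hε0 hε1 hB₃
        (fun s hs => hMB ⟨s, Finset.mem_range.1 hs⟩ y) (fun s hs => hhier s hs y) (hε' hε0.ne' y).2
      calc _ ≤ ((2 * K + 4) * B₃) ^ 2 * (epsN n ^ 2) ^ K := h
        _ ≤ C * nuN n ^ K := mul_le_mul_of_nonneg_right hC5 (pow_nonneg (nuN_pos n).le K)

end Summit.AnomalousDissipation.AnomalousDissipation.Theorems.TaylorWaveQuasiSteady.Truncation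

end
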